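import Summits.QuantumFields.YangMills.Theorems.LangevinControlUVOSLegsAtWeakCouplingCStubLocalityGaps
import HarnessLib

/-!
# The cut of a configuration at a gap: axis swap, centred configuration, the two clusters (E1-locality — file B)

Helper file for stub `stub_locality` of crux `OSLegsAtWeakCouplingC` (stmt-QuantumFields-16207, line `Sketch`,
continuation lead c2), continuing `…StubLocalityGaps` (file A).

For a slot `j = (μ, g)` of the gap coordinates the configuration `conf ε σ u` is re-listed by rank along the axis
`μ`, the axis `μ` is swapped into the time slot (`swapAxes μ`, a signed permutation of the axes, hence in the
invariance class of the line) and the whole configuration is translated in time so that the cut between the ranks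
`g` and `g + 1` straddles time `0` (`cutConf`): the LOWER cluster `loC` (ranks `≤ g`) then lies below time `−ε/2`
and the UPPER cluster `upC` (ranks `> g`) above time `ε/2`, with gaps `≥ ε` inside each (closed orthant `u ≥ 0`).
The product-bump function does not see these operations (`bumpFn_cutConf`: E3 + signed permutation + translation),
the lower cluster does not depend on the slot variable and the upper one is translated by it in time
(`loC_insertNth`, `upC_insertNth`), so the tree's two-cluster identity `osAdjoint_prodBumps_appendTensor` exhibits
the product-bump function at gaps `j.insertNth x u'` as the Osterwalder–Schrader two-cluster pairing
`S₁(ΘX* ⊗ T_{x e₀} U)` of the reflected reversed lower cluster `X` and the upper cluster `U` at slot value `0`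
(`apply_osAdjoint_appendTensor_cut`) — the input of the one-slot continuation.
-/

set_option autoImplicit false

noncomputable section

open scoped BigOperators
open Literature.MathematicalPhysics.QuantumLattice

namespace Summit.QuantumFields.YangMills.Theorems.OSLegsAtWeakCouplingC.Loc

open scoped ComplexConjugate SchwartzMap
open Literature.MathematicalPhysics.AQFT
open Literature.MathematicalPhysics.QuantumLattice.SchwingerFamily (timeVec)
open Summit.QuantumFields.YangMills.Cruxes.OSLegsAtWeakCouplingC.Sketch (IsSignedPerm Invariant)

variable {q : ℕ}

/-! ### The axis swap -/

/-- **The signed permutation exchanging the axes `0` and `μ`** (the identity for `μ = 0`). -/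
def swapAxes (μ : Fin 4) : EuclideanSpace ℝ (Fin 4) ≃ₗᵢ[ℝ] EuclideanSpace ℝ (Fin 4) :=
  LinearIsometryEquiv.piLpCongrLeft 2 ℝ ℝ (Equiv.swap (0 : Fin 4) μ)

/-- Coordinates after the swap. -/
theorem swapAxes_apply (μ : Fin 4) (x : EuclideanSpace ℝ (Fin 4)) (k : Fin 4) :
    swapAxes μ x k = x (Equiv.swap (0 : Fin 4) μ k) := by
  simp [swapAxes, LinearIsometryEquiv.piLpCongrLeft_apply, Equiv.piCongrLeft', Equiv.symm_swap]

/-- The new time coordinate is the old `μ`-coordinate. -/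
theorem swapAxes_apply_zero (μ : Fin 4) (x : EuclideanSpace ℝ (Fin 4)) : swapAxes μ x 0 = x μ := by
  rw [swapAxes_apply, Equiv.swap_apply_left]

/-- The swap on the axis vectors. -/
theorem swapAxes_single (μ i : Fin 4) (c : ℝ) :
    swapAxes μ (EuclideanSpace.single i c) = EuclideanSpace.single (Equiv.swap (0 : Fin 4) μ i) c :=
  LinearIsometryEquiv.piLpCongrLeft_single _ _ _

/-- The swap is an involution. -/
theorem swapAxes_symm (μ : Fin 4) : (swapAxes μ).symm = swapAxes μ := by
  rw [swapAxes, LinearIsometryEquiv.piLpCongrLeft_symm, Equiv.symm_swap]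

/-- The swap is a signed permutation of the axes (class `IsSignedPerm` of the line). -/
theorem isSignedPerm_swapAxes (μ : Fin 4) : IsSignedPerm (swapAxes μ) :=
  fun i => ⟨Equiv.swap (0 : Fin 4) μ i, Or.inl (swapAxes_single μ i 1)⟩

/-- The time component of `t e₀`. -/
theorem timeVec_apply_zero' (t : ℝ) : (timeVec t : EuclideanSpace ℝ (Fin 4)) 0 = t := by
  simp [timeVec]

/-- `t e₀` is `t • e₀`. -/
theorem timeVec_eq_smul (t : ℝ) : (timeVec t : EuclideanSpace ℝ (Fin 4)) = t • EuclideanSpace.single (0 : Fin 4) (1 : ℝ) := by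
  ext k
  simp [timeVec, PiLp.single_apply]

/-- `swapAxes μ (x e_μ) = x e₀`. -/
theorem swapAxes_smul_single_self (μ : Fin 4) (x : ℝ) :
    swapAxes μ (x • EuclideanSpace.single μ (1 : ℝ)) = timeVec x := by
  rw [map_smul, swapAxes_single, Equiv.swap_apply_right, timeVec_eq_smul]

/-! ### The centred, swapped, rank-ordered configuration of a cut -/

/-- **The cut configuration** for the slot `(μ, g)`: the points listed by rank along `μ`, the axis `μ` swapped into
the time slot, translated in time so that the point of rank `g` sits at time `−ε/2` (hence rank `g+1` at time
`ε/2 + u_{(μ,g)}`). -/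
def cutConf (ε : ℝ) (σ : Fin 4 → Equiv.Perm (Fin (q + 2))) (u : Fin (4 * q + 3 + 1) → ℝ) (μ : Fin 4)
    (g : Fin (q + 1)) (p : Fin (q + 2)) : EuclideanSpace ℝ (Fin 4) :=
  swapAxes μ (conf ε σ u (σ μ p)) - timeVec (cum ε u μ g + ε / 2)

/-- Time coordinates of the cut configuration. -/
theorem cutConf_apply_zero (ε : ℝ) (σ : Fin 4 → Equiv.Perm (Fin (q + 2))) (u : Fin (4 * q + 3 + 1) → ℝ)
    (μ : Fin 4) (g : Fin (q + 1)) (p : Fin (q + 2)) :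
    cutConf ε σ u μ g p 0 = cum ε u μ p - cum ε u μ g - ε / 2 := by
  rw [cutConf, PiLp.sub_apply, swapAxes_apply_zero, conf_rank, timeVec_apply_zero']
  ring

/-- Continuity of the cut configuration in the gaps. -/
theorem continuous_cutConf (ε : ℝ) (σ : Fin 4 → Equiv.Perm (Fin (q + 2))) (μ : Fin 4) (g : Fin (q + 1)) :
    Continuous fun u : Fin (4 * q + 3 + 1) → ℝ => cutConf ε σ u μ g := by
  refine continuous_pi fun p => ?_
  refine ((swapAxes μ).continuous.comp ((continuous_apply (σ μ p)).comp (continuous_conf ε σ))).sub ?_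
  have h : Continuous fun u : Fin (4 * q + 3 + 1) → ℝ => cum ε u μ g + ε / 2 := (continuous_cum ε μ _).add continuous_const
  have heq : (fun u : Fin (4 * q + 3 + 1) → ℝ => (timeVec (cum ε u μ g + ε / 2) : EuclideanSpace ℝ (Fin 4))) =
      fun u => (cum ε u μ g + ε / 2) • EuclideanSpace.single (0 : Fin 4) (1 : ℝ) := funext fun u => timeVec_eq_smul _
  rw [heq]
  exact h.smul continuous_const

/-- Separation of centres is preserved by reindexing along a permutation, isometries and translations. -/
theorem sepCenters_cutConf {ε r : ℝ} (hε : 0 ≤ ε) (hr : 2 * r < ε) (σ : Fin 4 → Equiv.Perm (Fin (q + 2)))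
    {u : Fin (4 * q + 3 + 1) → ℝ} (hu : ∀ l, 0 ≤ u l) (μ : Fin 4) (g : Fin (q + 1)) :
    SepCenters r (cutConf ε σ u μ g) := by
  intro i j hij
  have h := sepCenters_conf hε hr σ hu (σ μ i) (σ μ j) (fun h => hij ((σ μ).injective h))
  unfold cutConf
  rwa [dist_sub_right, LinearIsometryEquiv.dist_map]

/-- **The cut configuration has the same product-bump value**: E3 (rank reindexing), the signed permutation
`swapAxes μ` (invariance class + radial profile) and a translation. -/
theorem bumpFn_cutConf {ρ : 𝓢(EuclideanSpace ℝ (Fin 4), ℂ)} {S₁ : SchwingerFamily (EuclideanSpace ℝ (Fin 4))}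
    {r ε : ℝ} (hρ : tsupport (ρ : EuclideanSpace ℝ (Fin 4) → ℂ) ⊆ Metric.closedBall 0 r) (hε : 0 ≤ ε)
    (hr : 2 * r < ε) (hρP : ∀ (P : EuclideanSpace ℝ (Fin 4) ≃ₗᵢ[ℝ] EuclideanSpace ℝ (Fin 4)) (x : EuclideanSpace ℝ (Fin 4)), ρ (P x) = ρ x)
    (htrans : ∀ (n : ℕ) (t : EuclideanSpace ℝ (Fin 4)) (F : 𝓢((Fin n → EuclideanSpace ℝ (Fin 4)), ℂ)),
      IsOffDiagonal F → S₁ n (translateMulti t F) = S₁ n F)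
    (hE3 : S₁.toLabelled.IsSymmetric)
    (hsigned : ∀ R : EuclideanSpace ℝ (Fin 4) ≃ₗᵢ[ℝ] EuclideanSpace ℝ (Fin 4), IsSignedPerm R → Invariant S₁ R)
    (σ : Fin 4 → Equiv.Perm (Fin (q + 2))) {u : Fin (4 * q + 3 + 1) → ℝ} (hu : ∀ l, 0 ≤ u l)
    (μ : Fin 4) (g : Fin (q + 1)) :
    bumpFn ρ S₁ (q + 2) (cutConf ε σ u μ g) = bumpFn ρ S₁ (q + 2) (conf ε σ u) := by
  have hsep : SepCenters r (conf ε σ u) := sepCenters_conf hε hr σ hu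
  have hsep1 : SepCenters r (conf ε σ u ∘ σ μ) := fun i j hij => hsep _ _ (fun h => hij ((σ μ).injective h))
  have hsep2 : SepCenters r (fun p => swapAxes μ ((conf ε σ u ∘ σ μ) p)) := fun i j hij => by
    rw [LinearIsometryEquiv.dist_map]; exact hsep1 i j hij
  have h1 : cutConf ε σ u μ g = fun p => swapAxes μ ((conf ε σ u ∘ σ μ) p) + (-timeVec (cum ε u μ g + ε / 2)) := by
    funext p; rw [cutConf, sub_eq_add_neg]; rfl
  rw [h1, bumpFn_add_const hρ htrans hsep2, bumpFn_isometry hρ (fun x => hρP _ x) (hsigned _ (isSignedPerm_swapAxes μ)) hsep1,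
    bumpFn_comp_perm hρ hE3 hsep]

/-! ### The two clusters of a cut -/

/-- **Lower cluster**: ranks `0, …, g` of the cut configuration. -/
def loC (ε : ℝ) (σ : Fin 4 → Equiv.Perm (Fin (q + 2))) (u : Fin (4 * q + 3 + 1) → ℝ) (μ : Fin 4)
    (g : Fin (q + 1)) (p : Fin ((g : ℕ) + 1)) : EuclideanSpace ℝ (Fin 4) :=
  cutConf ε σ u μ g (Fin.castLE (by omega) p)

/-- **Upper cluster**: ranks `g+1, …, q+1` of the cut configuration. -/
def upC (ε : ℝ) (σ : Fin 4 → Equiv.Perm (Fin (q + 2))) (u : Fin (4 * q + 3 + 1) → ℝ) (μ : Fin 4)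
    (g : Fin (q + 1)) (p : Fin (q + 1 - g)) : EuclideanSpace ℝ (Fin 4) :=
  cutConf ε σ u μ g ⟨(g : ℕ) + 1 + p, by omega⟩

/-- The arities of the two clusters add up. -/
theorem loA_add_upB (g : Fin (q + 1)) : ((g : ℕ) + 1) + (q + 1 - g) = q + 2 := by omega

/-- **The appended clusters are the cut configuration** (reindexed along the arithmetic identity). -/
theorem append_loC_upC (ε : ℝ) (σ : Fin 4 → Equiv.Perm (Fin (q + 2))) (u : Fin (4 * q + 3 + 1) → ℝ)
    (μ : Fin 4) (g : Fin (q + 1)) :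
    Fin.append (loC ε σ u μ g) (upC ε σ u μ g) = cutConf ε σ u μ g ∘ Fin.cast (loA_add_upB g) := by
  funext l
  induction l using Fin.addCases with
  | left p =>
      rw [Fin.append_left, Function.comp_apply, loC]
      exact congrArg _ (Fin.ext (by simp))
  | right p =>
      rw [Fin.append_right, Function.comp_apply, upC]
      exact congrArg _ (Fin.ext (by simp))

/-- Continuity of the clusters in the gaps. -/
theorem continuous_loC (ε : ℝ) (σ : Fin 4 → Equiv.Perm (Fin (q + 2))) (μ : Fin 4) (g : Fin (q + 1)) :
    Continuous fun u : Fin (4 * q + 3 + 1) → ℝ => loC ε σ u μ g :=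
  continuous_pi fun _ => (continuous_apply _).comp (continuous_cutConf ε σ μ g)

/-- Continuity of the clusters in the gaps. -/
theorem continuous_upC (ε : ℝ) (σ : Fin 4 → Equiv.Perm (Fin (q + 2))) (μ : Fin 4) (g : Fin (q + 1)) :
    Continuous fun u : Fin (4 * q + 3 + 1) → ℝ => upC ε σ u μ g :=
  continuous_pi fun _ => (continuous_apply _).comp (continuous_cutConf ε σ μ g)

/-! ### Times of the clusters on the closed orthant -/

/-- **The lower cluster lies below time `−ε/2`**, with gaps `≥ ε` (ranks decrease ⇒ times decrease). -/
theorem loC_apply_zero (ε : ℝ) (σ : Fin 4 → Equiv.Perm (Fin (q + 2))) (u : Fin (4 * q + 3 + 1) → ℝ)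
    (μ : Fin 4) (g : Fin (q + 1)) (p : Fin ((g : ℕ) + 1)) :
    loC ε σ u μ g p 0 = -(cum ε u μ g - cum ε u μ p) - ε / 2 := by
  rw [loC, cutConf_apply_zero]
  simp only [Fin.val_castLE]
  ring

/-- **The upper cluster lies above time `ε/2`**. -/
theorem upC_apply_zero (ε : ℝ) (σ : Fin 4 → Equiv.Perm (Fin (q + 2))) (u : Fin (4 * q + 3 + 1) → ℝ)
    (μ : Fin 4) (g : Fin (q + 1)) (p : Fin (q + 1 - g)) :
    upC ε σ u μ g p 0 = (cum ε u μ ((g : ℕ) + 1 + p) - cum ε u μ ((g : ℕ) + 1)) + u (gidx q μ g) + ε / 2 := by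
  rw [upC, cutConf_apply_zero, cum_succ]
  simp only
  ring

/-- Time-ordering of the REFLECTED, REVERSED lower cluster: times `≥ ε/2`, increasing with gaps `≥ ε`. -/
theorem times_reflect_loC {ε : ℝ} (hε : 0 ≤ ε) (σ : Fin 4 → Equiv.Perm (Fin (q + 2)))
    {u : Fin (4 * q + 3 + 1) → ℝ} (hu : ∀ l, 0 ≤ u l) (μ : Fin 4) (g : Fin (q + 1)) :
    (∀ p : Fin ((g : ℕ) + 1), ε / 2 ≤ Literature.MathematicalPhysics.QuantumLattice.timeReflection 4 (loC ε σ u μ g (Fin.rev p)) 0) ∧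
    (∀ p p' : Fin ((g : ℕ) + 1), p < p' →
      ε ≤ Literature.MathematicalPhysics.QuantumLattice.timeReflection 4 (loC ε σ u μ g (Fin.rev p')) 0 -
        Literature.MathematicalPhysics.QuantumLattice.timeReflection 4 (loC ε σ u μ g (Fin.rev p)) 0) := by
  have hθ : ∀ p : Fin ((g : ℕ) + 1), Literature.MathematicalPhysics.QuantumLattice.timeReflection 4 (loC ε σ u μ g (Fin.rev p)) 0 =
      (cum ε u μ g - cum ε u μ ((g : ℕ) - p)) + ε / 2 := by
    intro p
    rw [Literature.MathematicalPhysics.QuantumLattice.timeReflection_apply, if_pos rfl, loC_apply_zero, Fin.val_rev]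
    have : (g : ℕ) + 1 - (p + 1) = g - p := by omega
    rw [this]; ring
  refine ⟨fun p => ?_, fun p p' hpp' => ?_⟩
  · rw [hθ]
    have h := cum_sub_cum_ge ε hu μ (Nat.sub_le g p) (by omega : (g : ℕ) ≤ q + 1)
    have : 0 ≤ ((g : ℝ) - ((g - p : ℕ) : ℝ)) * ε := mul_nonneg (by
      have : ((g - p : ℕ) : ℝ) ≤ g := by exact_mod_cast Nat.sub_le g p
      linarith) hε
    linarith
  · rw [hθ, hθ]
    have hlt : (p : ℕ) < p' := hpp'
    have h := cum_sub_cum_ge ε hu μ (by omega : (g : ℕ) - p' ≤ g - p) (by omega : (g : ℕ) - p ≤ q + 1)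
    have h1 : (1 : ℝ) ≤ ((g - p : ℕ) : ℝ) - ((g - p' : ℕ) : ℝ) := by
      have hp' : (p' : ℕ) ≤ g := Nat.lt_succ_iff.1 p'.isLt
      rw [Nat.cast_sub (by omega : (p : ℕ) ≤ g), Nat.cast_sub hp']
      have : (p : ℝ) + 1 ≤ p' := by exact_mod_cast hlt
      linarith
    nlinarith

/-- Time-ordering of the upper cluster: times `≥ ε/2`, increasing with gaps `≥ ε`. -/
theorem times_upC {ε : ℝ} (hε : 0 ≤ ε) (σ : Fin 4 → Equiv.Perm (Fin (q + 2)))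
    {u : Fin (4 * q + 3 + 1) → ℝ} (hu : ∀ l, 0 ≤ u l) (μ : Fin 4) (g : Fin (q + 1)) :
    (∀ p : Fin (q + 1 - g), ε / 2 ≤ upC ε σ u μ g p 0) ∧
    (∀ p p' : Fin (q + 1 - g), p < p' → ε ≤ upC ε σ u μ g p' 0 - upC ε σ u μ g p 0) := by
  refine ⟨fun p => ?_, fun p p' hpp' => ?_⟩
  · rw [upC_apply_zero]
    have h := cum_sub_cum_ge ε hu μ (by omega : (g : ℕ) + 1 ≤ (g : ℕ) + 1 + p) (by omega : (g : ℕ) + 1 + p ≤ q + 1)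
    have : 0 ≤ ((((g : ℕ) + 1 + p : ℕ) : ℝ) - (((g : ℕ) + 1 : ℕ) : ℝ)) * ε := mul_nonneg (by push_cast; linarith) hε
    linarith [hu (gidx q μ g)]
  · rw [upC_apply_zero, upC_apply_zero]
    have hlt : (p : ℕ) < p' := hpp'
    have h := cum_sub_cum_ge ε hu μ (by omega : (g : ℕ) + 1 + p ≤ (g : ℕ) + 1 + p') (by omega : (g : ℕ) + 1 + p' ≤ q + 1)
    have h1 : (1 : ℝ) ≤ ((((g : ℕ) + 1 + p' : ℕ) : ℝ) - (((g : ℕ) + 1 + p : ℕ) : ℝ)) := by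
      push_cast
      have : (p : ℝ) + 1 ≤ p' := by exact_mod_cast hlt
      linarith
    nlinarith

/-! ### Dependence on the slot variable -/

/-- Below the level of the slot nothing moves. -/
theorem cum_insertNth_of_le (ε : ℝ) (j : Fin (4 * q + 3 + 1)) (x : ℝ) (u' : Fin (4 * q + 3) → ℝ) {p : ℕ}
    (hp : p ≤ ((gapEquiv q j).2 : ℕ)) :
    cum ε (j.insertNth x u') (gapEquiv q j).1 p = cum ε (j.insertNth (0 : ℝ) u') (gapEquiv q j).1 p := by
  rw [cum_insertNth]
  have : ¬ ((gapEquiv q j).1 = (gapEquiv q j).1 ∧ ((gapEquiv q j).2 : ℕ) < p) := fun h => by omega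
  rw [if_neg this, add_zero]

/-- **The lower cluster does not depend on the slot variable.** -/
theorem loC_insertNth (ε : ℝ) (σ : Fin 4 → Equiv.Perm (Fin (q + 2))) (j : Fin (4 * q + 3 + 1)) (x : ℝ)
    (u' : Fin (4 * q + 3) → ℝ) :
    loC ε σ (j.insertNth x u') (gapEquiv q j).1 (gapEquiv q j).2 =
      loC ε σ (j.insertNth (0 : ℝ) u') (gapEquiv q j).1 (gapEquiv q j).2 := by
  funext p
  rw [loC, loC, cutConf, cutConf, conf_insertNth, Equiv.symm_apply_apply, cum_insertNth_of_le ε j x u' le_rfl]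
  have : ¬ ((gapEquiv q j).2 : ℕ) < ((Fin.castLE (by omega) p : Fin (q + 2)) : ℕ) := by
    rw [Fin.val_castLE]; have := p.isLt; omega
  rw [if_neg this, zero_smul, add_zero]

/-- **The upper cluster is translated in time by the slot variable.** -/
theorem upC_insertNth (ε : ℝ) (σ : Fin 4 → Equiv.Perm (Fin (q + 2))) (j : Fin (4 * q + 3 + 1)) (x : ℝ)
    (u' : Fin (4 * q + 3) → ℝ) (p : Fin (q + 1 - (gapEquiv q j).2)) :
    upC ε σ (j.insertNth x u') (gapEquiv q j).1 (gapEquiv q j).2 p =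
      upC ε σ (j.insertNth (0 : ℝ) u') (gapEquiv q j).1 (gapEquiv q j).2 p + timeVec x := by
  rw [upC, upC, cutConf, cutConf, conf_insertNth, Equiv.symm_apply_apply, cum_insertNth_of_le ε j x u' le_rfl]
  have : ((gapEquiv q j).2 : ℕ) < ((⟨((gapEquiv q j).2 : ℕ) + 1 + p, by omega⟩ : Fin (q + 2)) : ℕ) := by
    simp only; omega
  rw [if_pos this, map_add, swapAxes_smul_single_self]
  abel

/-! ### The two-cluster identity for the cut -/

/-- `bumpFn` does not see the reindexing of the arity. -/
theorem bumpFn_comp_cast (ρ : 𝓢(EuclideanSpace ℝ (Fin 4), ℂ)) (S₁ : SchwingerFamily (EuclideanSpace ℝ (Fin 4)))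
    {a b : ℕ} (h : a = b) (c : Fin b → EuclideanSpace ℝ (Fin 4)) :
    bumpFn ρ S₁ a (c ∘ Fin.cast h) = bumpFn ρ S₁ b c := by
  subst h
  rfl

/-- **The OS two-cluster test function of the cut is the product bump of the slot configuration**: with
`X = ⊗ ρ(· − θ loC(rev ·))` (reflected, reversed lower cluster at slot value `0`) and `U = ⊗ ρ(· − upC ·)` (upper
cluster at slot value `0`), `ΘX* ⊗ T_{x e₀} U` is the product bump over the cut configuration at slot value `x`. -/
theorem osAdjoint_appendTensor_cut {ρ : 𝓢(EuclideanSpace ℝ (Fin 4), ℂ)}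
    (hρθ : ∀ x, ρ (Literature.MathematicalPhysics.QuantumLattice.timeReflection 4 x) = ρ x) (hρre : ∀ x, conj (ρ x) = ρ x)
    (ε : ℝ) (σ : Fin 4 → Equiv.Perm (Fin (q + 2))) (j : Fin (4 * q + 3 + 1)) (x : ℝ) (u' : Fin (4 * q + 3) → ℝ) :
    (osAdjoint (prodBumps ρ ((gapEquiv q j).2 + 1)
        (fun p => Literature.MathematicalPhysics.QuantumLattice.timeReflection 4
          (loC ε σ (j.insertNth (0 : ℝ) u') (gapEquiv q j).1 (gapEquiv q j).2 (Fin.rev p))))).appendTensor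
      (translateMulti (timeVec x) (prodBumps ρ (q + 1 - (gapEquiv q j).2)
        (upC ε σ (j.insertNth (0 : ℝ) u') (gapEquiv q j).1 (gapEquiv q j).2))) =
      prodBumps ρ (((gapEquiv q j).2 : ℕ) + 1 + (q + 1 - (gapEquiv q j).2))
        (cutConf ε σ (j.insertNth x u') (gapEquiv q j).1 (gapEquiv q j).2 ∘ Fin.cast (loA_add_upB _)) := by
  have hup : upC ε σ (j.insertNth x u') (gapEquiv q j).1 (gapEquiv q j).2 =
      fun p => upC ε σ (j.insertNth (0 : ℝ) u') (gapEquiv q j).1 (gapEquiv q j).2 p + timeVec x :=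
    funext (upC_insertNth ε σ j x u')
  rw [osAdjoint_prodBumps_appendTensor ρ hρθ hρre, ← append_loC_upC, loC_insertNth ε σ j x u', hup]

/-- **The slot representation of the product-bump function**: for gaps in the closed orthant,
`S₁(ΘX* ⊗ T_{x e₀} U) = 𝒰(conf ε σ (j.insertNth x u'))`. -/
theorem apply_osAdjoint_appendTensor_cut {ρ : 𝓢(EuclideanSpace ℝ (Fin 4), ℂ)} {S₁ : SchwingerFamily (EuclideanSpace ℝ (Fin 4))}
    {r ε : ℝ} (hρ : tsupport (ρ : EuclideanSpace ℝ (Fin 4) → ℂ) ⊆ Metric.closedBall 0 r) (hε : 0 ≤ ε)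
    (hr : 2 * r < ε) (hρP : ∀ (P : EuclideanSpace ℝ (Fin 4) ≃ₗᵢ[ℝ] EuclideanSpace ℝ (Fin 4)) (x : EuclideanSpace ℝ (Fin 4)), ρ (P x) = ρ x)
    (hρre : ∀ x, conj (ρ x) = ρ x)
    (htrans : ∀ (n : ℕ) (t : EuclideanSpace ℝ (Fin 4)) (F : 𝓢((Fin n → EuclideanSpace ℝ (Fin 4)), ℂ)),
      IsOffDiagonal F → S₁ n (translateMulti t F) = S₁ n F)
    (hE3 : S₁.toLabelled.IsSymmetric)
    (hsigned : ∀ R : EuclideanSpace ℝ (Fin 4) ≃ₗᵢ[ℝ] EuclideanSpace ℝ (Fin 4), IsSignedPerm R → Invariant S₁ R)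
    (σ : Fin 4 → Equiv.Perm (Fin (q + 2))) (j : Fin (4 * q + 3 + 1)) {x : ℝ} (hx : 0 ≤ x)
    {u' : Fin (4 * q + 3) → ℝ} (hu' : ∀ l, 0 ≤ u' l) :
    S₁ (((gapEquiv q j).2 : ℕ) + 1 + (q + 1 - (gapEquiv q j).2))
      ((osAdjoint (prodBumps ρ ((gapEquiv q j).2 + 1)
        (fun p => Literature.MathematicalPhysics.QuantumLattice.timeReflection 4
          (loC ε σ (j.insertNth (0 : ℝ) u') (gapEquiv q j).1 (gapEquiv q j).2 (Fin.rev p))))).appendTensor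
        (translateMulti (timeVec x) (prodBumps ρ (q + 1 - (gapEquiv q j).2)
          (upC ε σ (j.insertNth (0 : ℝ) u') (gapEquiv q j).1 (gapEquiv q j).2)))) =
      bumpFn ρ S₁ (q + 2) (conf ε σ (j.insertNth x u')) := by
  have hu : ∀ l, 0 ≤ (j.insertNth x u' : Fin (4 * q + 3 + 1) → ℝ) l := by
    intro l
    rw [insertNth_apply_eq]
    refine add_nonneg (by split_ifs <;> [exact hx; exact le_rfl]) ?_
    induction l using Fin.succAboveCases j with
    | x => simp
    | p l' => simp [Fin.insertNth_apply_succAbove, hu' l']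
  rw [osAdjoint_appendTensor_cut (fun y => hρP _ y) hρre, ← bumpFn, bumpFn_comp_cast,
    bumpFn_cutConf hρ hε hr hρP htrans hE3 hsigned σ hu]

end Summit.QuantumFields.YangMills.Theorems.OSLegsAtWeakCouplingC.Loc

end
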